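import Literature.NumberTheory.LFunctions.Zhang2022.Section7Step7bTruncI
import Literature.NumberTheory.LFunctions.Zhang2022.Section7cCauchyStep
import Literature.NumberTheory.LFunctions.Zhang2022.Section7Eq711Assembly
import HarnessLib

/-!
# Zhang (2022) §7, proof of Proposition 7.1 (b): (7.15) holds outright; (7.11) ⇐ (7.13) ∧ small-`r`

Cell `siegel-zhang` (D-0069 width campaign), layer L2, seat sz-d26. Y. Zhang, arXiv:2211.02515v1
[Zhang2022LandauSiegel], an unrefereed manuscript under adjudication; WHAT THIS IS NOT: any claim
about its Theorems 1–2 or about Landau–Siegel zeros.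

* `eq715_holds` — DAG node `Z22:(7.15)` [Z22 p.38, tex L2024]
  "`R^{−3/2} Σ_{R≤r<2R} Σ*_{θ mod r} |𝔰(r,h,d;θ)| ≪ τ₅(d)hP²D^{−c}` for `dh < P₁`, `D ≤ R < P₁/(dh)`"
  (`Section7cStatements.Eq715 c′`) is a THEOREM for every `c′`: slice L2-t4's reduction
  `eq715_of_truncI : Step7bTruncI c′ → Eq715 c′` (Mellin step with the factor `hr`, large sieve
  for the `l`- and `p`-polynomials, Cauchy) composed with the `Δ`-localisation
  `Section7TruncI.step7bTruncI_holds` (Z22:§7.u037).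
* `eq711_of_eq713_smallR`, `eq711'_of_eq713_smallR` — the assembly `eq711_of` of (7.11) with its
  (7.15) input discharged: `Z22:(7.11)` now rests on (7.13) (`Eq713`) and the `1 < r < D` total
  (`Step7bSmallR`, GAP-LEDGER G-adj2-1) alone.

[cite: Zhang2022LandauSiegel, §7 (7.11)–(7.15) pp.37–39, tex L1984–L2058]
-/

noncomputable section

namespace Literature.NumberTheory.LFunctions.Zhang2022.Section7cStatements

/-- **Z22:(7.15)** [Z22 p.38, tex L2024] DISCHARGED: `Eq715 c′` holds for every `c′` — for all
large `D` under (A), `𝐚₁` admissible (7.2), `dh < P₁`, `D ≤ R < P₁/(dh)`: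
`R^{−3/2} Σ_{R≤r<2R} Σ*_{θ} |𝔰(r,h,d;θ)| ≤ C·τ₅(d)·h·P²·D^{−c}`; = `eq715_of_truncI` (L2-t4,
§7.u038–u041) applied to `Section7TruncI.step7bTruncI_holds` (§7.u037).
[cite: Zhang2022LandauSiegel, §7 (7.15) p.38, tex L2024–L2058] -/
theorem eq715_holds (c' : ℝ) : Eq715 c' :=
  eq715_of_truncI c' (Section7TruncI.step7bTruncI_holds c')

/-- **Z22:(7.11) reduced** [Z22 p.37, tex L1980]: (7.11) (`Iface.Eq711 c′`, the literal reading)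
follows from (7.13) (`Eq713 c′`) and the `1 < r < D` total (`Step7bSmallR c′`) — the (7.15) input
of `eq711_of` is the theorem `eq715_holds`. [cite: Zhang2022LandauSiegel, §7 (7.11) p.37] -/
theorem eq711_of_eq713_smallR (c' : ℝ) (h713 : Eq713 c') (hsmall : Step7bSmallR c') :
    Iface.Eq711 c' :=
  eq711_of c' h713 hsmall (eq715_holds c')

/-- **Z22:(7.11) reduced**, owner's statement [Z22 p.37, tex L1980]: `Section7bStatements.Eq711 c′`
follows from `Eq713 c′` and `Step7bSmallR c′`. [cite: Zhang2022LandauSiegel, §7 (7.11) p.37] -/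
theorem eq711'_of_eq713_smallR (c' : ℝ) (h713 : Eq713 c') (hsmall : Step7bSmallR c') :
    Section7bStatements.Eq711 c' :=
  eq711'_of c' h713 hsmall (eq715_holds c')

end Literature.NumberTheory.LFunctions.Zhang2022.Section7cStatements
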